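import Literature.Computability.Complexity.MoebiusBoundedDepth
import Literature.NumberTheory.LFunctions.MoebiusWalshCircuits
import HarnessLib

/-!
# Green 2012 for `μ` / `λ`: the `Computability` facts versus the `LFunctions` facts (proved bridges)

Topic `Literature/Computability/Complexity`. Everything in this file is PROVED (theorems only); it
is the proofs companion of `MoebiusBoundedDepth.lean`, whose four named facts

* `Green2012_moebius_walshCoeff`, `Green2012_liouville_walshCoeff` (Green 2012, Proposition 1 for
  `μ` and its printed `λ`-remark, cube form `cubeFourierCoeff (f ∘ val) S`, all `n`, `1 ≤ |S|`),
* `Green2012_moebius_boundedDepth`, `Green2012_liouville_boundedDepth` (Green 2012, Theorem 1 for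
  `μ` / `λ`, all `n`, sign `sgn ∘ K.eval`),

were vendored a second time, in the vocabulary of
`Literature/NumberTheory/LFunctions/MoebiusWalshCircuits.lean`
(`Literature.NumberTheory.LFunctions.green_moebius_fourierWalsh`, `…green_liouville_fourierWalsh`:
`|walshSum g S| / 2ⁿ`, `1 ≤ n`, `S.Nonempty`; `…green_moebius_ACd`, `…green_liouville_ACd`:
`|circuitCorrelation g C| / 2ⁿ`, `1 ≤ n`). We prove that the two renderings of each printed
statement are EQUIVALENT,

* `Green2012_moebius_walshCoeff_iff`, `Green2012_liouville_walshCoeff_iff` — Proposition 1: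
  `walshSum g S / 2ⁿ = ĝ(S)` (`walshSum_div_two_pow_eq_cubeFourierCoeff`), `S.Nonempty ↔ 1 ≤ |S|`,
  and the extra case `n = 0` of the `Computability` form is vacuous (`Fin 0` has no nonempty subset);
* `Green2012_moebius_boundedDepth_iff`, `Green2012_liouville_boundedDepth_iff` — Theorem 1:
  `circuitCorrelation g C = -Σ_x g(val x) sgn (C x)` (`circuitCorrelation_eq_neg_sum_sgn`), and
  the extra case `n = 0` of the `Computability` form holds with the constant `max K 0` because the
  only point of the `0`-cube has value `val = 0` and `μ(0) = λ(0) = 0`;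

so that each `Computability` fact is discharged the moment its `LFunctions` twin is
(`Green2012_liouville_walshCoeff_holds := Green2012_liouville_walshCoeff_iff.2 ‹_›`, etc.); the
deep input — Proposition 1 itself (Kátai's Proposition 2, Green's Theorem 3 for `2`-power moduli
= `Literature.NumberTheory.LFunctions.green_moebius_character_twoPower`, the minor-arc bound for
`Σ μ(x) e(θx)`, the Harman–Kátai lemma) — is NOT proved here and no new named fact is introduced.

## References

* B. Green, *On (not) computing the Möbius function using bounded depth circuits*, Combin.
  Probab. Comput. 21 (2012) 942–951 (arXiv:1103.4991): Theorem 1, Proposition 1, §1 remark on `λ`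
  ("All of the results in this paper hold equally well for the Liouville function"), §2. [Green2012]
-/

noncomputable section

open Finset
open Literature.Probability.RandomGraphs.LowDegree (walsh sgn)
open Literature.Computability.Complexity.LowDegree (cubeFourierCoeff)
open Literature.NumberTheory.LFunctions (walshSum circuitCorrelation)

namespace Literature.Computability.Complexity

/-! ### The two vocabularies -/

/-- The `LFunctions` Walsh sum is `2ⁿ` times the cube coefficient of `x ↦ g(Σ_j x_j 2^j)`:
`walshSum g S / 2ⁿ = ĝ(S)` (both sides unfold to the same sum: `walsh S x = ∏_{i ∈ S} sgn (x i)`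
with `sgn b = if b then -1 else 1`). [folklore] -/
theorem walshSum_div_two_pow_eq_cubeFourierCoeff (g : ℕ → ℤ) (n : ℕ) (S : Finset (Fin n)) :
    walshSum g S / 2 ^ n =
      cubeFourierCoeff (fun x : Fin n → Bool => (g (bitsToNat (List.ofFn x)) : ℝ)) S := by
  unfold walshSum cubeFourierCoeff walsh sgn
  rfl

/-- The `LFunctions` circuit correlation (sign convention `C(x) = true ↦ +1`) is minus the
`sgn`-correlation of this topic (`sgn true = -1`): `circuitCorrelation g C = -Σ_x g(val x) sgn (C x)`.
[folklore] -/
theorem circuitCorrelation_eq_neg_sum_sgn (g : ℕ → ℤ) (n : ℕ) (C : Circuit (Fin n)) :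
    circuitCorrelation g C =
      -∑ x : Fin n → Bool, (g (bitsToNat (List.ofFn x)) : ℝ) * sgn (C.eval x) := by
  unfold circuitCorrelation
  rw [← Finset.sum_neg_distrib]
  refine Finset.sum_congr rfl fun x _ => ?_
  cases C.eval x <;> simp [sgn]

/-! ### Proposition 1: cube coefficients versus `walshSum / 2ⁿ` -/

/-- **The two renderings of a Proposition-1-type bound agree** (any `g : ℕ → ℤ`): the
`Computability` form (all `n`, `1 ≤ |S|`, `|ĝₙ(S)|` with `ĝₙ = cubeFourierCoeff (g ∘ val)`) is
equivalent to the `LFunctions` form (`1 ≤ n`, `S.Nonempty`, `|walshSum g S| / 2ⁿ`), because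
`walshSum g S / 2ⁿ = ĝₙ(S)` and `Fin 0` has no nonempty subset. [cite: Green2012, Proposition 1] -/
theorem walshCoeff_bound_iff (g : ℕ → ℤ) :
    (∃ c : ℝ, 0 < c ∧ ∃ C : ℝ, ∀ n : ℕ, ∀ S : Finset (Fin n), 1 ≤ S.card →
      |cubeFourierCoeff (fun x : Fin n → Bool => (g (bitsToNat (List.ofFn x)) : ℝ)) S|
        ≤ C * S.card * Real.exp (-(c * Real.sqrt n / S.card))) ↔
    (∃ c : ℝ, 0 < c ∧ ∃ K : ℝ, ∀ n : ℕ, 1 ≤ n → ∀ S : Finset (Fin n), S.Nonempty →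
      |walshSum g S| / 2 ^ n ≤ K * S.card * Real.exp (-(c * Real.sqrt n / S.card))) := by
  have key : ∀ (n : ℕ) (S : Finset (Fin n)), |walshSum g S| / 2 ^ n =
      |cubeFourierCoeff (fun x : Fin n → Bool => (g (bitsToNat (List.ofFn x)) : ℝ)) S| := fun n S => by
    rw [← walshSum_div_two_pow_eq_cubeFourierCoeff, abs_div, abs_of_pos (by positivity : (0 : ℝ) < 2 ^ n)]
  constructor
  · rintro ⟨c, hc, C, hC⟩
    refine ⟨c, hc, C, fun n _ S hS => ?_⟩
    rw [key]
    exact hC n S (Finset.card_pos.2 hS)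
  · rintro ⟨c, hc, K, hK⟩
    refine ⟨c, hc, K, fun n S hS => ?_⟩
    have hSne : S.Nonempty := Finset.card_pos.1 hS
    have hn : 1 ≤ n := by
      rcases Nat.eq_zero_or_pos n with rfl | h
      · obtain ⟨i, -⟩ := hSne
        exact i.elim0
      · exact h
    rw [← key]
    exact hK n hn S hSne

/-- **Dedup bridge (Proposition 1 for `μ`).** `Green2012_moebius_walshCoeff` (this topic) `↔`
`Literature.NumberTheory.LFunctions.green_moebius_fourierWalsh`. [cite: Green2012, Proposition 1] -/
theorem Green2012_moebius_walshCoeff_iff :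
    Green2012_moebius_walshCoeff ↔ Literature.NumberTheory.LFunctions.green_moebius_fourierWalsh :=
  walshCoeff_bound_iff (fun m => ArithmeticFunction.moebius m)

/-- **Dedup bridge (Proposition 1 for `λ`).** `Green2012_liouville_walshCoeff` (this topic) `↔`
`Literature.NumberTheory.LFunctions.green_liouville_fourierWalsh`.
[cite: Green2012, Proposition 1 and §1 remark on λ] -/
theorem Green2012_liouville_walshCoeff_iff :
    Green2012_liouville_walshCoeff ↔ Literature.NumberTheory.LFunctions.green_liouville_fourierWalsh :=
  walshCoeff_bound_iff (fun m => ArithmeticFunction.liouville m)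

/-! ### Theorem 1: `sgn ∘ K.eval` sums versus `circuitCorrelation / 2ⁿ` -/

/-- On the `0`-cube every point has value `val x = 0`, so a correlation sum against `g` with
`g 0 = 0` vanishes. [folklore] -/
theorem sum_cube_zero_eq_zero (g : ℕ → ℤ) (hg : g 0 = 0) (w : (Fin 0 → Bool) → ℝ) :
    ∑ x : Fin 0 → Bool, (g (bitsToNat (List.ofFn x)) : ℝ) * w x = 0 := by
  refine Finset.sum_eq_zero fun x _ => ?_
  rw [List.ofFn_zero, bitsToNat_nil, hg, Int.cast_zero, zero_mul]

/-- **The two renderings of a Theorem-1-type bound agree** (any `g : ℕ → ℤ` with `g 0 = 0`): the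
`Computability` form (all `n`, `|Σ_x g(val x) sgn (K x)| / 2ⁿ`) is equivalent to the `LFunctions`
form (`1 ≤ n`, `|circuitCorrelation g K| / 2ⁿ`), because `circuitCorrelation g K = -Σ_x g(val x) sgn (K x)`
and at `n = 0` the sum vanishes (`g 0 = 0`), where the constant `max K 0 ≥ 0` works.
[cite: Green2012, Theorem 1] -/
theorem boundedDepth_bound_iff (g : ℕ → ℤ) (hg : g 0 = 0) :
    (∃ c : ℝ, 0 < c ∧ ∃ C : ℝ, ∀ d : ℕ, 1 ≤ d → ∀ n : ℕ, ∀ K : Circuit (Fin n),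
      K.IsOver acBasis → K.depth ≤ d → K.size ≤ n ^ d →
        |(∑ x : Fin n → Bool, (g (bitsToNat (List.ofFn x)) : ℝ) * sgn (K.eval x)) / 2 ^ n|
          ≤ C * Real.exp (d * Real.log n - c * (n : ℝ) ^ ((1 : ℝ) / (6 * d)))) ↔
    (∃ c : ℝ, 0 < c ∧ ∃ K : ℝ, ∀ (d n : ℕ), 1 ≤ d → 1 ≤ n →
      ∀ C : Circuit (Fin n), C.IsOver acBasis → C.depth ≤ d → C.size ≤ n ^ d →
        |circuitCorrelation g C| / 2 ^ n ≤
          K * Real.exp (d * Real.log n - c * (n : ℝ) ^ (1 / (6 * (d : ℝ))))) := by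
  have key : ∀ (n : ℕ) (C : Circuit (Fin n)), |circuitCorrelation g C| / 2 ^ n =
      |(∑ x : Fin n → Bool, (g (bitsToNat (List.ofFn x)) : ℝ) * sgn (C.eval x)) / 2 ^ n| := fun n C => by
    rw [circuitCorrelation_eq_neg_sum_sgn, abs_neg, abs_div, abs_of_pos (by positivity : (0 : ℝ) < 2 ^ n)]
  constructor
  · rintro ⟨c, hc, C, hC⟩
    refine ⟨c, hc, C, fun d n hd _ K hK hdepth hsize => ?_⟩
    rw [key]
    exact hC d hd n K hK hdepth hsize
  · rintro ⟨c, hc, K, hK⟩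
    refine ⟨c, hc, max K 0, fun d hd n C hC hdepth hsize => ?_⟩
    rcases Nat.eq_zero_or_pos n with rfl | hn
    · rw [sum_cube_zero_eq_zero g hg, zero_div, abs_zero]
      exact mul_nonneg (le_max_right K 0) (Real.exp_pos _).le
    · rw [← key]
      exact (hK d n hd hn C hC hdepth hsize).trans
        (mul_le_mul_of_nonneg_right (le_max_left K 0) (Real.exp_pos _).le)

/-- **Dedup bridge (Theorem 1 for `μ`).** `Green2012_moebius_boundedDepth` (this topic) `↔`
`Literature.NumberTheory.LFunctions.green_moebius_ACd`. [cite: Green2012, Theorem 1] -/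
theorem Green2012_moebius_boundedDepth_iff :
    Green2012_moebius_boundedDepth ↔ Literature.NumberTheory.LFunctions.green_moebius_ACd :=
  boundedDepth_bound_iff (fun m => ArithmeticFunction.moebius m) (by simp)

/-- **Dedup bridge (Theorem 1 for `λ`).** `Green2012_liouville_boundedDepth` (this topic) `↔`
`Literature.NumberTheory.LFunctions.green_liouville_ACd`.
[cite: Green2012, Theorem 1 and §1 remark on λ] -/
theorem Green2012_liouville_boundedDepth_iff :
    Green2012_liouville_boundedDepth ↔ Literature.NumberTheory.LFunctions.green_liouville_ACd :=
  boundedDepth_bound_iff (fun m => ArithmeticFunction.liouville m) (by simp)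

end Literature.Computability.Complexity

end
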